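import Mathlib.Tactic.Module
import Literature.Analysis.FluidPDE.HardSpherePhaseSpace
import HarnessLib

/-!
# Lipschitz bounds for the elastic reflection law (registered stub `stub_reflectVelPerturbation`,
# refutation line `ignition-cascade-refutation`, crux `InfluenceLocality`, stmt-AtomisticToContinuum-13916)

The elastic reflection law of the tree,
`reflectVel n (v, w) = (v − (⟪v − w, n⟫/‖n‖²) n, w + (⟪v − w, n⟫/‖n‖²) n)`, is Lipschitz in the
velocities and in the impact vector. With `π_m x := (⟪x, m⟫/‖m‖²) m` the orthogonal projection onto the
line of `m`, and `w = v₁ − v₂`, `w₀ = v₁⁰ − v₂⁰` the relative velocities,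

* `(reflectVel n p).1 − (reflectVel n₀ p₀).1 = (p.1 − p₀.1) − (π_n w − π_{n₀} w₀)`,
  `(reflectVel n p).2 − (reflectVel n₀ p₀).2 = (p.2 − p₀.2) + (π_n w − π_{n₀} w₀)`;
* `π_n w − π_{n₀} w₀ = π_n (w − w₀) + (π_n w₀ − π_{n₀} w₀)` with `‖π_n x‖ ≤ ‖x‖`
  (`norm_lineProj_le`, Cauchy–Schwarz), and for impact vectors of equal length `‖n‖ = ‖n₀‖ = ε > 0`
  (contacts of spheres of diameter `ε`)
  `π_n w₀ − π_{n₀} w₀ = ε⁻² (⟪w₀, n − n₀⟫ n + ⟪w₀, n₀⟫ (n − n₀))`, of norm `≤ 2‖w₀‖‖n − n₀‖/ε`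
  (`norm_lineProj_sub_lineProj_le`).

This gives the registered statement `stub_reflectVelPerturbation` with the explicit constants
`‖pᵢ − p₀ᵢ‖ + ‖w − w₀‖ + 2‖w₀‖‖n − n₀‖/ε`. Pure inner-product-space algebra; nothing here asserts a
Theses decl.
-/

namespace Summit.AtomisticToContinuum.HydrodynamicLimit.Theorems.InfluenceLocality.Negative

open Literature.Analysis.FluidPDE
open scoped InnerProductSpace

noncomputable section

variable {E : Type*} [NormedAddCommGroup E] [InnerProductSpace ℝ E]

/-- The projection onto the line of `n`, as it enters `reflectVel`, is a contraction:
`‖(⟪x, n⟫/‖n‖²) n‖ ≤ ‖x‖` (Cauchy–Schwarz; trivially true at the junk value `n = 0`). -/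
theorem norm_lineProj_le (n x : E) : ‖(⟪x, n⟫_ℝ / ‖n‖ ^ 2) • n‖ ≤ ‖x‖ := by
  by_cases hn : n = 0
  · simp [hn]
  have hn' : 0 < ‖n‖ := norm_pos_iff.2 hn
  rw [norm_smul, Real.norm_eq_abs, abs_div, abs_of_nonneg (by positivity : (0 : ℝ) ≤ ‖n‖ ^ 2),
    div_mul_eq_mul_div, div_le_iff₀ (by positivity)]
  calc |⟪x, n⟫_ℝ| * ‖n‖ ≤ ‖x‖ * ‖n‖ * ‖n‖ := by
        gcongr
        exact abs_real_inner_le_norm x n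
    _ = ‖x‖ * ‖n‖ ^ 2 := by ring

/-- Lipschitz dependence of the line projection on the direction, for directions of equal length
`‖n‖ = ‖n₀‖ = ε > 0`: `‖(⟪x, n⟫/‖n‖²) n − (⟪x, n₀⟫/‖n₀‖²) n₀‖ ≤ 2‖x‖‖n − n₀‖/ε`, from
`⟪x, n⟫ n − ⟪x, n₀⟫ n₀ = ⟪x, n − n₀⟫ n + ⟪x, n₀⟫ (n − n₀)`. -/
theorem norm_lineProj_sub_lineProj_le {n n₀ : E} {ε : ℝ} (hε : 0 < ε) (hn : ‖n‖ = ε)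
    (hn₀ : ‖n₀‖ = ε) (x : E) :
    ‖(⟪x, n⟫_ℝ / ‖n‖ ^ 2) • n - (⟪x, n₀⟫_ℝ / ‖n₀‖ ^ 2) • n₀‖ ≤ 2 * ‖x‖ * ‖n - n₀‖ / ε := by
  have key : (⟪x, n⟫_ℝ / ‖n‖ ^ 2) • n - (⟪x, n₀⟫_ℝ / ‖n₀‖ ^ 2) • n₀ =
      (ε ^ 2)⁻¹ • (⟪x, n - n₀⟫_ℝ • n + ⟪x, n₀⟫_ℝ • (n - n₀)) := by
    rw [hn, hn₀, inner_sub_right]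
    module
  have hbound : ‖⟪x, n - n₀⟫_ℝ • n + ⟪x, n₀⟫_ℝ • (n - n₀)‖ ≤ 2 * ‖x‖ * ‖n - n₀‖ * ε :=
    calc ‖⟪x, n - n₀⟫_ℝ • n + ⟪x, n₀⟫_ℝ • (n - n₀)‖
          ≤ ‖⟪x, n - n₀⟫_ℝ • n‖ + ‖⟪x, n₀⟫_ℝ • (n - n₀)‖ := norm_add_le _ _
      _ = |⟪x, n - n₀⟫_ℝ| * ε + |⟪x, n₀⟫_ℝ| * ‖n - n₀‖ := by
          rw [norm_smul, norm_smul, Real.norm_eq_abs, Real.norm_eq_abs, hn]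
      _ ≤ ‖x‖ * ‖n - n₀‖ * ε + ‖x‖ * ε * ‖n - n₀‖ := by
          gcongr
          · exact abs_real_inner_le_norm x (n - n₀)
          · calc |⟪x, n₀⟫_ℝ| ≤ ‖x‖ * ‖n₀‖ := abs_real_inner_le_norm x n₀
              _ = ‖x‖ * ε := by rw [hn₀]
      _ = 2 * ‖x‖ * ‖n - n₀‖ * ε := by ring
  rw [key, norm_smul, norm_inv, Real.norm_eq_abs, abs_of_pos (by positivity),
    inv_mul_le_iff₀ (by positivity)]
  calc ‖⟪x, n - n₀⟫_ℝ • n + ⟪x, n₀⟫_ℝ • (n - n₀)‖ ≤ 2 * ‖x‖ * ‖n - n₀‖ * ε := hbound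
    _ = ε ^ 2 * (2 * ‖x‖ * ‖n - n₀‖ / ε) := by
        field_simp

/-- The velocity corrections of `reflectVel n p` and `reflectVel n₀ p₀` differ by at most
`‖w − w₀‖ + 2‖w₀‖‖n − n₀‖/ε` (`w = p.1 − p.2`, `w₀ = p₀.1 − p₀.2`, `‖n‖ = ‖n₀‖ = ε > 0`):
split `π_n w − π_{n₀} w₀ = π_n (w − w₀) + (π_n w₀ − π_{n₀} w₀)` and use `norm_lineProj_le`,
`norm_lineProj_sub_lineProj_le`. -/
theorem norm_reflectVel_correction_sub_le {n n₀ : E} {ε : ℝ} (hε : 0 < ε) (hn : ‖n‖ = ε)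
    (hn₀ : ‖n₀‖ = ε) (w w₀ : E) :
    ‖(⟪w, n⟫_ℝ / ‖n‖ ^ 2) • n - (⟪w₀, n₀⟫_ℝ / ‖n₀‖ ^ 2) • n₀‖ ≤
      ‖w - w₀‖ + 2 * ‖w₀‖ * ‖n - n₀‖ / ε := by
  have hsplit : (⟪w, n⟫_ℝ / ‖n‖ ^ 2) • n - (⟪w₀, n₀⟫_ℝ / ‖n₀‖ ^ 2) • n₀ =
      (⟪w - w₀, n⟫_ℝ / ‖n‖ ^ 2) • n +
        ((⟪w₀, n⟫_ℝ / ‖n‖ ^ 2) • n - (⟪w₀, n₀⟫_ℝ / ‖n₀‖ ^ 2) • n₀) := by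
    rw [inner_sub_left, sub_div, sub_smul]
    abel
  rw [hsplit]
  exact (norm_add_le _ _).trans
    (add_le_add (norm_lineProj_le n (w - w₀)) (norm_lineProj_sub_lineProj_le hε hn hn₀ w₀))

/-- **Registered stub `stub_reflectVelPerturbation`** (line `ignition-cascade-refutation`, crux
`InfluenceLocality`). Lipschitz bounds for the elastic reflection law with explicit constants: for impact
vectors `n, n₀` of equal length `ε > 0` (contacts of spheres of diameter `ε`) and velocity pairs `p, p₀`,
each post-collisional velocity of `reflectVel n p` is within
`‖pᵢ − p₀ᵢ‖ + ‖(p.1 − p.2) − (p₀.1 − p₀.2)‖ + 2‖p₀.1 − p₀.2‖‖n − n₀‖/ε` of that of `reflectVel n₀ p₀`. -/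
theorem stub_reflectVelPerturbation {E : Type*} [NormedAddCommGroup E] [InnerProductSpace ℝ E]
    {n n₀ : E} {ε : ℝ} (hε : 0 < ε) (hn : ‖n‖ = ε) (hn₀ : ‖n₀‖ = ε) (p p₀ : E × E) :
    ‖(reflectVel n p).1 - (reflectVel n₀ p₀).1‖ ≤
        ‖p.1 - p₀.1‖ + ‖(p.1 - p.2) - (p₀.1 - p₀.2)‖ + 2 * ‖p₀.1 - p₀.2‖ * ‖n - n₀‖ / ε ∧
      ‖(reflectVel n p).2 - (reflectVel n₀ p₀).2‖ ≤
        ‖p.2 - p₀.2‖ + ‖(p.1 - p.2) - (p₀.1 - p₀.2)‖ + 2 * ‖p₀.1 - p₀.2‖ * ‖n - n₀‖ / ε := by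
  have hcorr := norm_reflectVel_correction_sub_le hε hn hn₀ (p.1 - p.2) (p₀.1 - p₀.2)
  constructor
  · have h1 : (reflectVel n p).1 - (reflectVel n₀ p₀).1 = (p.1 - p₀.1) -
        ((⟪p.1 - p.2, n⟫_ℝ / ‖n‖ ^ 2) • n - (⟪p₀.1 - p₀.2, n₀⟫_ℝ / ‖n₀‖ ^ 2) • n₀) := by
      simp only [reflectVel]
      abel
    rw [h1]
    calc _ ≤ ‖p.1 - p₀.1‖ +
          ‖(⟪p.1 - p.2, n⟫_ℝ / ‖n‖ ^ 2) • n - (⟪p₀.1 - p₀.2, n₀⟫_ℝ / ‖n₀‖ ^ 2) • n₀‖ := norm_sub_le _ _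
      _ ≤ _ := by linarith
  · have h2 : (reflectVel n p).2 - (reflectVel n₀ p₀).2 = (p.2 - p₀.2) +
        ((⟪p.1 - p.2, n⟫_ℝ / ‖n‖ ^ 2) • n - (⟪p₀.1 - p₀.2, n₀⟫_ℝ / ‖n₀‖ ^ 2) • n₀) := by
      simp only [reflectVel]
      abel
    rw [h2]
    calc _ ≤ ‖p.2 - p₀.2‖ +
          ‖(⟪p.1 - p.2, n⟫_ℝ / ‖n‖ ^ 2) • n - (⟪p₀.1 - p₀.2, n₀⟫_ℝ / ‖n₀‖ ^ 2) • n₀‖ := norm_add_le _ _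
      _ ≤ _ := by linarith

end

end Summit.AtomisticToContinuum.HydrodynamicLimit.Theorems.InfluenceLocality.Negative
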